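import Summits.CriticalPhenomena.PercolationContinuityZ3.Theorems.Transplant.CayleySkeletonClassThree
import Summits.CriticalPhenomena.PercolationContinuityZ3.Theorems.Transplant.PlanarSkeletonFrm1
import HarnessLib

/-!
# The frames-only Cayley datum `CayleyFrm₂` — INPUT(Cay(Γ;S)) = (φ, C_1 connected) and NOTHING about symmetry, modulo the single-type frames-only node N2

builds on p205010 (kernel theorem, internal audit signed; external expert review pending) — nothing in this file uses p205010; the frames-only node
`SamePDropOfSkeletonFrm₁` (file `PlanarSkeletonFrm1`) is an OPEN `Prop` of this programme, taken as a HYPOTHESIS wherever it appears; NOTHING is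
claimed about it.  Lane `prim-bschramm`, seat `prim-bschramm-p4` gen 13 (PART C3 of `P4-GENERAL.md`: INPUT(G) as weak as possible; §35 "the N2
payoff rows").  Helper file (`--supports stmt-CriticalPhenomena-4575 --as helper`).  Statements, instances and one-line reductions only.

WHAT.  `CayleyNeg₂` (file `CayleySkeletonConn`, gen 11) reads the `{±1}` interface `PlanarSkeletonNeg` on a Cayley graph: an additive `φ : Γ → ℤ²`
of unit range with unit steps in `S`, ONE `S`-preserving automorphism `ν` with `φν = −φ`, and the unit cylinder `C_1 = {‖φ‖_∞ ≤ 1}` of `Cay(Γ;S)`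
connected; with N1 closed (`samePDropOfSkeletonNeg₁_holds`, p329520) it gives `θ_g(p) = 0 ∀ p ≤ p_c` unconditionally.  The lane's frames-only node
N2 deletes the inversion from the interface (`PlanarSkeletonFrm`, 8 fields).  This file types the corresponding Cayley datum and its customers:
* §1 **`CayleyFrm₂ Γ S`** := `CayleyNeg₂` WITHOUT `ν` — `(φ additive, ‖φ(S)‖_∞ ≤ 1, e₀, e₁ ∈ φ(S), C_1 connected)`; `skeletonFrm : PlanarSkeletonFrm
  (Cay(Γ;S))` (one type, left translations as frames); **Φ2 at and below `p_c` DERIVED** (`cylSubcritical_of_le`, thick frames of gen 11: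
  `CylData₂.theta_cyl_criticalProb_eq_zeroE`); **`CayleyFrm₂.theta_eq_zero_of_le_of_frmNode₁ : SamePDropOfSkeletonFrm₁ → ∀ g, ∀ p ≤ p_c, θ_g(p) = 0`**
  — the post-N2 input sentence for Cayley graphs: `(φ, C_1 connected)`, no automorphism, no kernel criterion, no growth hypothesis;
* §2 forgetful map `CayleyNeg₂.toFrm₂` (every `{±1}` customer is an N2 customer) and the two SYMMETRY-FREE constructors:
  `CayleyFrm₂.ofKerLetters` — ANY group, `ker φ` generated by the kernel letters `S ∩ ker φ` (closure induction, gen 11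
  `CylBase.exists_inBox_of_mem_closure`); `CayleyFrm₂.ofClassThree` — ANY group of nilpotency class `≤ 3` with letters = kernel letters ∪
  `{s₀^{±1}, s₁^{±1}}` (gen 11 `CylBase.boxWalks_of_classThree`);
* §3 `NilThreeFrm.Data Γ` = gen 11's `NilThreeSigns.SignData` with BOTH automorphisms deleted (class `≤ 3`, symmetric generating letters, additive `φ`
  with letters in `ker φ ∪ {x^{±1}, y^{±1}}`) and **`NilThreeFrm.Data.theta_eq_zero_of_le_of_frmNode₁`**: modulo N2, `θ_g(p) = 0 ∀ p ≤ p_c` on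
  `Cay(Γ; A)` for EVERY nilpotent group of class `≤ 3` and EVERY letters-type generating set — no reversing symmetry (tier 3c of P4-GENERAL §34.3
  (4)(b): e.g. `N_{m,3}/K` for `K ≤ γ₂` NOT stable under the letter inversion, Heisenberg-type groups whose automorphism group does not realise
  `−1` on the letter quotient).
WHY THIS IS THE RIGHT SHAPE (P4-GENERAL §33.3/§33.8): the fields of `CayleyFrm₂` are exactly the fields of `PlanarSkeletonFrm` read on a Cayley
graph with one base type and left translations as frames (additivity ⟸ translating frames; (κ) ⟺ `C_1` connected by column/row reduction);
Φ2 is a theorem for them.  So when N2 closes, the C3 class map at the Cayley level reads INPUT = `(φ, C_1 connected)`; the residue is then (κ′)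
(finitely generated kernels with `C_1` disconnected — the letters-only free nilpotent groups of class `≥ 4`, for EVERY flat `φ`, §35.2) and
generating sets without a flat rank-2 letter quotient.
[cite: BenjaminiSchramm1996, Conj. 4; §2 (Cayley graphs)] [cite: KozmaNitzan2024, §1 p. 2 (approach 1); §4 p. 16 (Lemma 8: the lattice symmetries)]
[cite: AizenmanGrimmett1991, Thm 1 (essential enhancements)] [cite: MartineauTassion2017, §3.2]
-/

noncomputable section

namespace Summit.CriticalPhenomena.PercolationContinuityZ3.Theorems.Transplant

open SimpleGraph Walk Literature.Probability.LatticeModels Literature.Probability.Percolation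
open Literature.Barriers.CriticalPhenomena (countable_of_connected_of_locallyFinite)
open scoped Classical

/-! ## §1 `CayleyFrm₂`: the frames-only datum with the connected-cylinder criterion -/

/-- **INPUT, frames-only version, connected-cylinder criterion**: additive `φ : Γ → ℤ²` of unit range on `S` with unit steps in `S`, and the
cylinder `C_1 = {‖φ‖_∞ ≤ 1}` of `Cay(Γ;S)` connected — NO automorphism (`CayleyNeg₂` without `ν`).
[cite: KozmaNitzan2024, §4 p. 16 (Lemma 8)] [cite: BenjaminiSchramm1996, §2; Conj. 4] -/
structure CayleyFrm₂ (Γ : Type) [Group Γ] (S : Finset Γ) where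
  /-- the skeleton homomorphism `φ : Γ → ℤ²` -/
  φ : Γ → Site 2
  /-- additivity -/
  map_mul : ∀ g h : Γ, φ (g * h) = φ g + φ h
  /-- generators have sup-norm `≤ 1` -/
  lip : ∀ s ∈ S, ∀ i : Fin 2, |φ s i| ≤ 1
  /-- unit steps: some generator maps to each basis vector -/
  step : ∀ i : Fin 2, ∃ s ∈ S, φ s = Pi.single i 1
  /-- the cylinder `‖φ‖_∞ ≤ 1` of `Cay(Γ;S)` is connected -/
  cyl_one : ((mulCayley (S : Set Γ)).induce {g | φ g ∈ box 2 1}).Connected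

namespace CayleyFrm₂

variable {Γ : Type} [Group Γ] {S : Finset Γ} (C : CayleyFrm₂ Γ S)

/-- The base datum of a `CayleyFrm₂`. [folklore] -/
def base : CayCyl.CylBase Γ S where
  φ := C.φ
  map_mul := C.map_mul
  lip := C.lip
  s₀ := Classical.choose (C.step 0)
  s₀_mem := (Classical.choose_spec (C.step 0)).1
  φ_s₀ := (Classical.choose_spec (C.step 0)).2
  s₁ := Classical.choose (C.step 1)
  s₁_mem := (Classical.choose_spec (C.step 1)).1
  φ_s₁ := (Classical.choose_spec (C.step 1)).2

/-- `φ 1 = 0`. [folklore] -/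
theorem φ_one : C.φ 1 = 0 := C.base.φ_one

/-- **Every vertex of the unit cylinder with `φ = 0` is joined to `1` by a walk of `Cay(Γ;S)` all of whose vertices have `‖φ‖_∞ ≤ 1`** (from the
connectivity of `C_1`; no automorphism is involved). [folklore] -/
theorem exists_walk_inBox_one : ∀ k : Γ, C.φ k = 0 →
    ∃ w : (mulCayley (S : Set Γ)).Walk (1 : Γ) k, ∀ z ∈ w.support, C.base.φ z ∈ box 2 1 := by
  intro k hk
  have h1 : (1 : Γ) ∈ {g | C.φ g ∈ box 2 1} := by
    show C.φ 1 ∈ box 2 1; rw [C.φ_one]; exact zero_mem_box 2 1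
  have hk' : k ∈ {g | C.φ g ∈ box 2 1} := by show C.φ k ∈ box 2 1; rw [hk]; exact zero_mem_box 2 1
  obtain ⟨w⟩ := C.cyl_one.preconnected ⟨1, h1⟩ ⟨k, hk'⟩
  obtain ⟨w', hw'⟩ := CayCyl.exists_walk_of_induceWalk w
  exact ⟨w', fun z hz => hw' z hz⟩

/-- **The thick cylinder datum of a `CayleyFrm₂`** (radius `5`, by the telescoping lemma). [folklore] -/
def cylData₂ : CayCyl.CylData₂ Γ S := C.base.toCylData₂ 1 C.exists_walk_inBox_one

/-- **THE FRAMES-ONLY SKELETON OF A `CayleyFrm₂`**: one type (the identity), left multiplications as frames, degree bound `2|S|`, unit steps,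
cylinders connected for `ℓ ≥ 1` — and no point symmetry. [cite: KozmaNitzan2024, §4 p. 16 (Lemma 8)] [cite: BenjaminiSchramm1996, §2] -/
def skeletonFrm : PlanarSkeletonFrm (mulCayley (S : Set Γ)) where
  φ := C.φ
  lip := fun _ _ h i => by rw [abs_sub_comm]; exact C.base.lip_adj h i
  types := {1}
  frame := fun v => ⟨1, Finset.mem_singleton_self 1, leftMulIso S v, mul_one v, fun w => by
    show C.φ (v * w) = C.φ w + (C.φ v - C.φ 1)
    rw [C.map_mul, φ_one, sub_zero, add_comm]⟩
  Δ := 2 * S.card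
  degree_le := degree_mulCayley_le S
  step := fun v i σ => by
    obtain ⟨s, hs, hφ⟩ := C.step i
    have hs1 : s ≠ 1 := by
      intro h
      have h0 := congrFun hφ i
      rw [h, φ_one] at h0
      simp at h0
    rcases Int.units_eq_one_or σ with rfl | rfl
    · exact ⟨v * s, CayCyl.adj_mul_of_mem S (Or.inl hs) hs1 v, by rw [C.map_mul, hφ, Units.val_one]⟩
    · refine ⟨v * s⁻¹, CayCyl.adj_mul_of_mem S (Or.inr (by rw [inv_inv]; exact hs)) (inv_ne_one.2 hs1) v, ?_⟩
      rw [C.map_mul, show C.φ s⁻¹ = -C.φ s from C.base.φ_inv s, hφ, Units.val_neg, Units.val_one, Pi.single_neg]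
  cyl_connected := fun t ht ℓ hℓ => by
    rw [Finset.mem_singleton] at ht
    subst ht
    have e : {w | C.φ w - C.φ 1 ∈ box 2 ℓ} = C.cylData₂.enl.V ℓ := by
      ext w; simp [CayCyl.CylData.V, cylData₂, base, CayCyl.CylData₂.enl, CayCyl.CylBase.toCylData₂, φ_one]
    rw [e]
    exact C.cylData₂.cylG_connected_of_boxWalks C.exists_walk_inBox_one hℓ

/-- The skeleton map of `skeletonFrm` is `φ`. [folklore] -/
@[simp] theorem skeletonFrm_φ : C.skeletonFrm.φ = C.φ := rfl

/-- `skeletonFrm` has exactly one base type, the identity. [folklore] -/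
@[simp] theorem skeletonFrm_types : C.skeletonFrm.types = {1} := rfl

/-- **Φ2 AT AND BELOW `p_c` FOR EVERY `CayleyFrm₂`**: for `p ≤ p_c(Cay(Γ;S))` no cylinder of the skeleton percolates at `p` (thick frames:
`p_c ≤ p_c(C_{ℓ+11}) < p_c(C_ℓ)` or `p_c(C_ℓ) = 1`). [cite: AizenmanGrimmett1991, Thm 1 (essential enhancements)] [cite: Menshikov1987, Thm (graph and subgraph)] -/
theorem cylSubcritical_of_le {p : unitInterval} (hp : (p : ℝ) ≤ criticalProb (mulCayley (S : Set Γ)) (1 : Γ)) :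
    C.skeletonFrm.CylSubcritical p := by
  intro t ht ℓ
  change t ∈ ({1} : Finset Γ) at ht
  rw [Finset.mem_singleton] at ht
  subst ht
  haveI : Countable Γ := countable_of_connected_of_locallyFinite _ (C.skeletonFrm.graph_connected (1 : Γ)) 1
  have e : {w | C.skeletonFrm.φ w - C.skeletonFrm.φ 1 ∈ box 2 ℓ} = C.cylData₂.enl.V ℓ := by
    ext w; simp [CayCyl.CylData.V, cylData₂, base, CayCyl.CylData₂.enl, CayCyl.CylBase.toCylData₂, skeletonFrm, φ_one]
  show theta ((mulCayley (S : Set Γ)).induce {w | C.skeletonFrm.φ w - C.skeletonFrm.φ 1 ∈ box 2 ℓ}) ⟨1, _⟩ _ = 0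
  rw [theta_induce_congr _ e]
  have h0 := C.cylData₂.theta_cyl_criticalProb_eq_zeroE (C.skeletonFrm.criticalProb_lt_one 1) ℓ
  have hmono : theta (C.cylData₂.cylG ℓ) ⟨1, C.cylData₂.one_mem_VE ℓ⟩ p ≤
      theta (C.cylData₂.cylG ℓ) ⟨1, C.cylData₂.one_mem_VE ℓ⟩ (criticalProbIOf (mulCayley (S : Set Γ)) (1 : Γ)) :=
    theta_mono_holds _ _ (Subtype.coe_le_coe.mp hp)
  have hnn : 0 ≤ theta (C.cylData₂.cylG ℓ) ⟨1, C.cylData₂.one_mem_VE ℓ⟩ p := MeasureTheory.measureReal_nonneg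
  linarith

include C in
/-- **CONDITIONAL THEOREM (the post-N2 input sentence for Cayley graphs): `θ_g(p) = 0` on `Cay(Γ; S)` for every `p ≤ p_c`, every vertex `g` and
every `CayleyFrm₂` — an additive unit-range `φ : Γ → ℤ²` with unit steps in `S` and the unit cylinder connected, NO symmetry — modulo the single-type
frames-only node `SamePDropOfSkeletonFrm₁` (OPEN; hypothesis `hN`).**  Φ2 is derived; quasi-transitivity, uniqueness / the exponential-growth split and
`p_c < 1` come with the node's one-liner. [cite: BenjaminiSchramm1996, Conj. 4; §2] -/
theorem theta_eq_zero_of_le_of_frmNode₁ {p : unitInterval} (hN : SamePDropOfSkeletonFrm₁) (g : Γ)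
    (hp : (p : ℝ) ≤ criticalProb (mulCayley (↑S : Set Γ)) g) : theta (mulCayley (↑S : Set Γ)) g p = 0 := by
  haveI : Countable Γ := countable_of_connected_of_locallyFinite _ (C.skeletonFrm.graph_connected g) g
  have hbase : theta (mulCayley (S : Set Γ)) (1 : Γ) (criticalProbIOf (mulCayley (S : Set Γ)) 1) = 0 :=
    continuity_of_frmNode₁ hN _ C.skeletonFrm (Finset.mem_singleton_self 1) rfl (C.cylSubcritical_of_le le_rfl)
  have hθ := theta_iso (leftMulIso S g) (1 : Γ) (criticalProbIOf (mulCayley (S : Set Γ)) 1)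
  have hpc := criticalProb_iso (leftMulIso S g) (1 : Γ)
  rw [leftMulIso_apply, mul_one] at hθ hpc
  have e : criticalProbIOf (mulCayley (S : Set Γ)) g = criticalProbIOf (mulCayley (S : Set Γ)) 1 := Subtype.ext hpc
  have hpc0 : theta (mulCayley (S : Set Γ)) g (criticalProbIOf (mulCayley (S : Set Γ)) g) = 0 := by rw [e, hθ]; exact hbase
  have hmono : theta (mulCayley (S : Set Γ)) g p ≤ theta (mulCayley (S : Set Γ)) g (criticalProbIOf (mulCayley (S : Set Γ)) g) :=
    theta_mono_holds _ _ (Subtype.coe_le_coe.mp hp)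
  have hnn : 0 ≤ theta (mulCayley (S : Set Γ)) g p := MeasureTheory.measureReal_nonneg
  linarith

include C in
/-- **`θ_g(p_c) = 0` at every vertex of `Cay(Γ;S)` for every `CayleyFrm₂`, modulo N2** (the `p = p_c` case). [cite: BenjaminiSchramm1996, Conj. 4] -/
theorem criticalContinuity_of_frmNode₁ (hN : SamePDropOfSkeletonFrm₁) (g : Γ) :
    theta (mulCayley (↑S : Set Γ)) g (criticalProbIOf (mulCayley (↑S : Set Γ)) g) = 0 :=
  C.theta_eq_zero_of_le_of_frmNode₁ hN g le_rfl

end CayleyFrm₂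

/-! ## §2 Every `{±1}` customer is a frames-only customer; the two symmetry-free constructors -/

namespace CayleyNeg₂

variable {Γ : Type} [Group Γ] {S : Finset Γ} (C : CayleyNeg₂ Γ S)

/-- **Forget the inversion**: every `CayleyNeg₂` is a `CayleyFrm₂`. [folklore] -/
def toFrm₂ : CayleyFrm₂ Γ S where
  φ := C.φ
  map_mul := C.map_mul
  lip := C.lip
  step := C.step
  cyl_one := C.cyl_one

/-- `toFrm₂.φ = φ`. [folklore] -/
@[simp] theorem toFrm₂_φ : C.toFrm₂.φ = C.φ := rfl

end CayleyNeg₂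

namespace CayCyl

namespace CylBase

variable {Γ : Type} [Group Γ] {S : Finset Γ} (B : CylBase Γ S)

/-- **`CayleyFrm₂` from box walks**: a base datum all of whose kernel elements are joined to `1` inside the unit cylinder. [folklore] -/
def toFrm₂ (h : ∀ k : Γ, B.φ k = 0 → ∃ w : (mulCayley (S : Set Γ)).Walk (1 : Γ) k, B.InBox 1 w) : CayleyFrm₂ Γ S where
  φ := B.φ
  map_mul := B.map_mul
  lip := B.lip
  step := fun i => by
    fin_cases i
    · exact ⟨B.s₀, B.s₀_mem, B.φ_s₀⟩
    · exact ⟨B.s₁, B.s₁_mem, B.φ_s₁⟩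
  cyl_one := by
    have hc := (B.toCylData₂ 1 h).cylG_connected_of_boxWalks h le_rfl
    have e : {g | B.φ g ∈ box 2 1} = (B.toCylData₂ 1 h).enl.V 1 := by
      ext w; simp [CylData.V, CylData₂.enl, toCylData₂]
    rw [e]; exact hc

/-- `(toFrm₂ h).φ = φ`. [folklore] -/
@[simp] theorem toFrm₂_φ (h : ∀ k : Γ, B.φ k = 0 → ∃ w : (mulCayley (S : Set Γ)).Walk (1 : Γ) k, B.InBox 1 w) : (B.toFrm₂ h).φ = B.φ := rfl

/-- **KERNEL LETTERS (any group)**: if `ker φ` is generated by the kernel letters `S ∩ ker φ`, every kernel element is joined to `1` inside the unit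
cylinder (each kernel letter by its one-edge walk; closure induction). [folklore] -/
theorem boxWalks_of_kerLetters (hker : ∀ k : Γ, B.φ k = 0 → k ∈ Subgroup.closure {s : Γ | s ∈ S ∧ B.φ s = 0}) (k : Γ) (hk : B.φ k = 0) :
    ∃ w : (mulCayley (S : Set Γ)).Walk (1 : Γ) k, B.InBox 1 w := by
  have hT : ∀ t ∈ {s : Γ | s ∈ S ∧ B.φ s = 0}, B.φ t = 0 ∧ ∃ w : (mulCayley (S : Set Γ)).Walk (1 : Γ) t, B.InBox 1 w := by
    rintro t ⟨htS, ht0⟩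
    refine ⟨ht0, ?_⟩
    by_cases ht1 : t = 1
    · subst ht1
      exact ⟨Walk.nil, B.inBox_of_length_le Walk.nil (by simp)⟩
    · have hadj : (mulCayley (S : Set Γ)).Adj (1 : Γ) ((1 : Γ) * t) := adj_mul_of_mem S (Or.inl htS) ht1 1
      refine ⟨(Walk.cons hadj Walk.nil).copy rfl (one_mul t), B.inBox_of_length_le _ ?_⟩
      rw [Walk.length_copy, Walk.length_cons, Walk.length_nil]
  exact (B.exists_inBox_of_mem_closure 1 hT (hker k hk)).2

end CylBase

end CayCyl

namespace CayleyFrm₂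

variable {Γ : Type} [Group Γ] {S : Finset Γ}

/-- **CONSTRUCTOR I (any group, no symmetry): `CayleyFrm₂` from the KERNEL-LETTER criterion** — additive unit-range `φ` with unit steps `s₀, s₁ ∈ S`
and `ker φ = ⟨S ∩ ker φ⟩`. [cite: KozmaNitzan2024, §4 p. 16 (Lemma 8)] -/
def ofKerLetters (B : CayCyl.CylBase Γ S) (hker : ∀ k : Γ, B.φ k = 0 → k ∈ Subgroup.closure {s : Γ | s ∈ S ∧ B.φ s = 0}) :
    CayleyFrm₂ Γ S :=
  B.toFrm₂ (B.boxWalks_of_kerLetters hker)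

/-- `(ofKerLetters B h).φ = B.φ`. [folklore] -/
@[simp] theorem ofKerLetters_φ (B : CayCyl.CylBase Γ S) (hker : ∀ k : Γ, B.φ k = 0 → k ∈ Subgroup.closure {s : Γ | s ∈ S ∧ B.φ s = 0}) :
    (ofKerLetters B hker).φ = B.φ := rfl

/-- **CONSTRUCTOR II (class `≤ 3`, no symmetry): `CayleyFrm₂` for a group of nilpotency class `≤ 3`** with a symmetric generating `S` all of whose
letters are kernel letters or `s₀^{±1}, s₁^{±1}` (gen 11's `boxWalks_of_classThree`). [cite: KozmaNitzan2024, §4 p. 16 (Lemma 8)] -/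
def ofClassThree (B : CayCyl.CylBase Γ S) (h3 : (⊤ : Subgroup Γ).lowerCentralSeries 3 = ⊥) (hS : Subgroup.closure (S : Set Γ) = ⊤)
    (hsymm : ∀ s ∈ S, s⁻¹ ∈ S) (hSφ : ∀ s ∈ S, B.φ s = 0 ∨ s = B.s₀ ∨ s = B.s₀⁻¹ ∨ s = B.s₁ ∨ s = B.s₁⁻¹) : CayleyFrm₂ Γ S :=
  B.toFrm₂ (B.boxWalks_of_classThree h3 hS hsymm hSφ)

/-- `(ofClassThree …).φ = B.φ`. [folklore] -/
@[simp] theorem ofClassThree_φ (B : CayCyl.CylBase Γ S) (h3 : (⊤ : Subgroup Γ).lowerCentralSeries 3 = ⊥)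
    (hS : Subgroup.closure (S : Set Γ) = ⊤) (hsymm : ∀ s ∈ S, s⁻¹ ∈ S)
    (hSφ : ∀ s ∈ S, B.φ s = 0 ∨ s = B.s₀ ∨ s = B.s₀⁻¹ ∨ s = B.s₁ ∨ s = B.s₁⁻¹) : (ofClassThree B h3 hS hsymm hSφ).φ = B.φ := rfl

/-- **THEOREM (kernel letters, any group, modulo N2): `θ_g(p) = 0` for all `p ≤ p_c` on `Cay(Γ;S)`** whenever `Γ` carries an additive unit-range
`φ : Γ → ℤ²` with unit steps in `S` whose kernel is generated by the kernel letters — no automorphism of `(Γ, S)` is asked for.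
[cite: BenjaminiSchramm1996, Conj. 4; §2] -/
theorem theta_eq_zero_of_le_of_kerLetters_of_frmNode₁ (hN : SamePDropOfSkeletonFrm₁) (B : CayCyl.CylBase Γ S)
    (hker : ∀ k : Γ, B.φ k = 0 → k ∈ Subgroup.closure {s : Γ | s ∈ S ∧ B.φ s = 0}) {p : unitInterval} (g : Γ)
    (hp : (p : ℝ) ≤ criticalProb (mulCayley (↑S : Set Γ)) g) : theta (mulCayley (↑S : Set Γ)) g p = 0 :=
  (ofKerLetters B hker).theta_eq_zero_of_le_of_frmNode₁ hN g hp

/-- **THEOREM (class `≤ 3`, letters only, modulo N2): `θ_g(p) = 0` for all `p ≤ p_c` on `Cay(Γ;S)`** for every group of nilpotency class `≤ 3` and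
every symmetric generating `S` consisting of kernel letters and `s₀^{±1}, s₁^{±1}` of an additive `φ : Γ → ℤ²` — no automorphism of `(Γ, S)` is asked
for (tier 3c of the class map). [cite: BenjaminiSchramm1996, Conj. 4; §2] -/
theorem theta_eq_zero_of_le_of_classThree_of_frmNode₁ (hN : SamePDropOfSkeletonFrm₁) (B : CayCyl.CylBase Γ S)
    (h3 : (⊤ : Subgroup Γ).lowerCentralSeries 3 = ⊥) (hS : Subgroup.closure (S : Set Γ) = ⊤) (hsymm : ∀ s ∈ S, s⁻¹ ∈ S)
    (hSφ : ∀ s ∈ S, B.φ s = 0 ∨ s = B.s₀ ∨ s = B.s₀⁻¹ ∨ s = B.s₁ ∨ s = B.s₁⁻¹) {p : unitInterval} (g : Γ)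
    (hp : (p : ℝ) ≤ criticalProb (mulCayley (↑S : Set Γ)) g) : theta (mulCayley (↑S : Set Γ)) g p = 0 :=
  (ofClassThree B h3 hS hsymm hSφ).theta_eq_zero_of_le_of_frmNode₁ hN g hp

end CayleyFrm₂

/-! ## §3 `NilThreeFrm.Data`: class `≤ 3`, letters only, NO automorphism -/

namespace NilThreeFrm

/-- **Class-`≤ 3` letters datum WITHOUT symmetry**: a group of nilpotency class `≤ 3`, finite symmetric generating letters `A`, an additive
`φ : Γ → ℤ²` with distinguished letters `x ↦ e₀`, `y ↦ e₁` and every letter in `ker φ ∪ {x^{±1}, y^{±1}}` (gen 11's `NilThreeSigns.SignData`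
without `ν, κ`; gen 12's `NilThreeNeg.NegData` without `ν`). [cite: KozmaNitzan2024, §4 p. 16 (Lemma 8)] [cite: BenjaminiSchramm1996, §2] -/
structure Data (Γ : Type) [Group Γ] where
  /-- the letters -/
  A : Finset Γ
  /-- the letters are symmetric -/
  symm : ∀ a ∈ A, a⁻¹ ∈ A
  /-- the letters generate -/
  gen : Subgroup.closure (A : Set Γ) = ⊤
  /-- class `≤ 3` -/
  nil : (⊤ : Subgroup Γ).lowerCentralSeries 3 = ⊥
  /-- the skeleton -/
  φ : Γ → Site 2
  /-- additivity -/
  map_mul : ∀ g h : Γ, φ (g * h) = φ g + φ h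
  /-- the first distinguished letter -/
  x : Γ
  /-- it is a letter -/
  x_mem : x ∈ A
  /-- its height -/
  φ_x : φ x = Pi.single 0 1
  /-- the second distinguished letter -/
  y : Γ
  /-- it is a letter -/
  y_mem : y ∈ A
  /-- its height -/
  φ_y : φ y = Pi.single 1 1
  /-- every letter is in the kernel or among `x^{±1}, y^{±1}` -/
  letters : ∀ a ∈ A, φ a = 0 ∨ a = x ∨ a = x⁻¹ ∨ a = y ∨ a = y⁻¹

namespace Data

variable {Γ : Type} [Group Γ] (T : Data Γ)

/-- `φ g⁻¹ = −φ g`. [folklore] -/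
theorem φ_inv (g : Γ) : T.φ g⁻¹ = -T.φ g := KerGen.phi_inv T.φ T.map_mul g

/-- The base datum (skeleton and the two distinguished letters; the letters have sup-norm `≤ 1`). [folklore] -/
def base : CayCyl.CylBase Γ T.A where
  φ := T.φ
  map_mul := T.map_mul
  lip := fun s hs j => by
    rcases T.letters s hs with h | rfl | rfl | rfl | rfl
    · rw [h]; simp
    · rw [T.φ_x]; fin_cases j <;> simp
    · rw [T.φ_inv, T.φ_x]; fin_cases j <;> simp
    · rw [T.φ_y]; fin_cases j <;> simp
    · rw [T.φ_inv, T.φ_y]; fin_cases j <;> simp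
  s₀ := T.x
  s₀_mem := T.x_mem
  φ_s₀ := T.φ_x
  s₁ := T.y
  s₁_mem := T.y_mem
  φ_s₁ := T.φ_y

/-- **The `CayleyFrm₂` datum of a class-3 letters datum** (connected unit cylinder from `boxWalks_of_classThree`; no symmetry). [folklore] -/
def cayleyFrm₂ : CayleyFrm₂ Γ T.A :=
  CayleyFrm₂.ofClassThree T.base T.nil T.gen T.symm T.letters

/-- `cayleyFrm₂.φ = φ`. [folklore] -/
@[simp] theorem cayleyFrm₂_φ : T.cayleyFrm₂.φ = T.φ := rfl

include T in
/-- **THEOREM (class `≤ 3`, letters only, NO reversing symmetry — modulo N2): `θ_g(p) = 0` for every `p ≤ p_c` at every vertex of `Cay(Γ; A)`**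
for every nilpotent group of class `≤ 3` and every letters-type generating set.  This is tier 3c of the C3 class map at class `≤ 3`: the quotients
`N_{m,3}/K` (`K ≤ γ₂`) that are NOT stable under the letter inversion, Heisenberg-type groups with generating sets admitting no abelianisation-reversing
automorphism; unconditional versions need `ν` (`NilThreeNeg.NegData`, N1) or `ν, κ` (`NilThreeSigns.SignData`, D″).
[cite: BenjaminiSchramm1996, Conj. 4; §2] -/
theorem theta_eq_zero_of_le_of_frmNode₁ (hN : SamePDropOfSkeletonFrm₁) {p : unitInterval} (g : Γ)
    (hp : (p : ℝ) ≤ criticalProb (mulCayley (↑T.A : Set Γ)) g) : theta (mulCayley (↑T.A : Set Γ)) g p = 0 :=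
  T.cayleyFrm₂.theta_eq_zero_of_le_of_frmNode₁ hN g hp

include T in
/-- **`θ_g(p_c) = 0` on `Cay(Γ; A)` for every class-3 letters datum, modulo N2** (the `p = p_c` case). [cite: BenjaminiSchramm1996, Conj. 4] -/
theorem criticalContinuity_of_frmNode₁ (hN : SamePDropOfSkeletonFrm₁) (g : Γ) :
    theta (mulCayley (↑T.A : Set Γ)) g (criticalProbIOf (mulCayley (↑T.A : Set Γ)) g) = 0 :=
  T.theta_eq_zero_of_le_of_frmNode₁ hN g le_rfl

end Data

end NilThreeFrm

end Summit.CriticalPhenomena.PercolationContinuityZ3.Theorems.Transplant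

end
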